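import Literature.NumberTheory.LFunctions.GaussianThetaSeries
import HarnessLib

/-!
# Weight-one theta `L`-series of `ℤ[i]` at `s = 1` as a limit of damped lattice sums

Topic `Literature/NumberTheory/LFunctions`, continuing `GaussianThetaSeries`: for `M ≥ 1` and a
coefficient `ψ : ℤ[i] → ℂ` periodic modulo `M`, the entire continuation
`Literature.NumberTheory.LFunctions.GaussianTheta.thetaLFunction M ψ` of the Dirichlet series
`∑_{x ≠ 0} ψ(x) x N(x)^{-s}` (absolutely convergent only for `Re s > 3/2`) satisfies, **at the
point `s = 1`** (the centre of the critical strip of the Hecke `L`-series `L(E_n, s)` of the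
congruent number curves, `CongruentNumberCurveHeckeSeries`):

* `thetaLFunction_one` — `L_ψ(1) = (π/M) ∫₀^∞ θ_ψ(t) dt`, the theta function
  `θ_ψ(t) = ∑_x ψ(x) x e^{-π t N(x)/M}` being integrable on `(0, ∞)` (`integrableOn_theta`: it
  is `O(t^{-b})` at `0⁺` and `O(t^{-A})` at `∞` for all `A, b`);
* `hasSum_setIntegral_Ioi_theta` — for `y > 0`,
  `∫_y^∞ θ_ψ(t) dt = (M/π) ∑_x ψ(x) (x/N(x)) e^{-π y N(x)/M}` (termwise integration, absolutely
  justified on `[y, ∞)`);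
* `tendsto_tsum_thetaLFunction_one` —
  **`L_ψ(1) = lim_{y → 0⁺} ∑_{x ∈ ℤ[i]} ψ(x) (x / N(x)) e^{-y N(x)}`**: the value at `1` is the
  Abel–Gauss regularisation of the formal (conditionally convergent at best) lattice sum
  `∑ ψ(x)/x̄`.

This is the first step of the classical evaluation of `L(E_n, 1)` for the curves
`E_n : y² = x³ - n² x` as an Eisenstein–Kronecker sum over `ℤ[i]` (Birch–Swinnerton-Dyer,
*Notes on elliptic curves II*, Crelle 218 (1965), §3: `L_D(1)` as a finite combination of values
of Weierstrass functions of the lemniscatic lattice; Tunnell 1983, p. 329 uses the resulting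
values `L(E¹, 1) = β/4`, `L(E³, 1) = β/√3`). Everything here is proved; no named facts are
introduced.

## Proof

`θ_ψ` is continuous on `(0, ∞)` with the two-sided decay of `GaussianThetaSeries`, so
Mathlib's `mellinConvergent_of_isBigO_rpow` at `s = 1` gives integrability, and `Γ(1) = 1` gives
`thetaLFunction_one`. For `y > 0` the series `∑_x ψ(x) x e^{-π t N(x)/M}` may be integrated
termwise over `(y, ∞)` (`MeasureTheory.hasSum_integral_of_summable_integral_norm`; the integrals
of the norms are `‖ψ(x)‖ √N(x) · M/(π N(x)) · e^{-π y N(x)/M}`, summable by comparison with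
`∑ N(x)^{-2}`), and `∫_y^∞ e^{-π t N/M} dt = (M/(π N)) e^{-π y N/M}`. Finally
`∫_y^∞ θ_ψ → ∫₀^∞ θ_ψ` as `y → 0⁺` by dominated convergence, and the change of variable
`y ↦ M y/π` removes the normalisation of the exponent.

## References

* B. J. Birch, H. P. F. Swinnerton-Dyer, *Notes on elliptic curves. II*, J. reine angew. Math.
  218 (1965) 79–108, §3.
* N. Koblitz, *Introduction to Elliptic Curves and Modular Forms*, GTM 97, 2nd ed. (1993),
  Ch. II §5–§6 (the Hecke `L`-series `L(E_n, s)`, its theta function, the critical value).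
-/

noncomputable section

open Complex Real Set Filter Topology Asymptotics MeasureTheory

namespace Literature.NumberTheory.LFunctions

namespace GaussianTheta

/-! ### Gaussian sums over `ℤ[i]` converge -/

/-- `e^{-u} ≤ 2/u²` for `u > 0` (from `u²/2 ≤ e^u`). [folklore] -/
theorem exp_neg_le_two_div_sq {u : ℝ} (hu : 0 < u) : rexp (-u) ≤ 2 / u ^ 2 := by
  have h := Real.pow_div_factorial_le_exp u hu.le 2
  rw [Nat.factorial_two, Nat.cast_ofNat] at h
  rw [Real.exp_neg, inv_eq_one_div, div_le_div_iff₀ (Real.exp_pos u) (by positivity)]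
  linarith

/-- **`∑_{x ∈ ℤ[i]} e^{-c N(x)}` converges for `c > 0`** (comparison with
`∑_{x ≠ 0} N(x)^{-2}`, `summable_norm_rpow_neg`, through `e^{-u} ≤ 2/u²`). [folklore] -/
theorem summable_exp_neg_mul_norm {c : ℝ} (hc : 0 < c) :
    Summable fun x : GaussianInt ↦ rexp (-c * ((x.norm : ℤ) : ℝ)) := by
  let g : GaussianInt → ℝ := fun x ↦
    2 / c ^ 2 * (((x.norm : ℤ) : ℝ)) ^ (-(2 : ℝ)) + if x = 0 then 1 else 0
  have hg : Summable g :=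
    ((summable_norm_rpow_neg (r := 2) (by norm_num)).mul_left (2 / c ^ 2)).add
      (summable_of_ne_finset_zero (s := {0}) (by
        intro x hx
        rw [Finset.mem_singleton] at hx
        exact if_neg hx))
  refine Summable.of_nonneg_of_le (fun x ↦ (Real.exp_pos _).le) (fun x ↦ ?_) hg
  rcases eq_or_ne x 0 with rfl | hx
  · have h0 : (((0 : GaussianInt).norm : ℤ) : ℝ) = 0 := by simp
    simp only [g, h0, mul_zero, Real.exp_zero, if_true,
      Real.zero_rpow (by norm_num : (-(2 : ℝ)) ≠ 0)]
    norm_num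
  · have hN : (0 : ℝ) < ((x.norm : ℤ) : ℝ) := by exact_mod_cast GaussianInt.norm_pos.mpr hx
    have hle := exp_neg_le_two_div_sq (mul_pos hc hN)
    simp only [g, if_neg hx, add_zero]
    rw [Real.rpow_neg hN.le, Real.rpow_two, neg_mul]
    calc rexp (-(c * ((x.norm : ℤ) : ℝ))) ≤ 2 / (c * ((x.norm : ℤ) : ℝ)) ^ 2 := hle
      _ = 2 / c ^ 2 * (((x.norm : ℤ) : ℝ) ^ 2)⁻¹ := by
          rw [mul_pow]
          field_simp

variable (M : ℕ) [NeZero M] (ψ : GaussianInt → ℂ)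

/-! ### `θ_ψ` is integrable on `(0, ∞)`; the value of the continuation at `s = 1` -/

/-- **`θ_ψ` is integrable on `(0, ∞)`**: it is continuous there, `O(t^{-2})` at `∞` and `O(1)`
at `0⁺` (`GaussianThetaSeries`), so the Mellin integral converges at `s = 1`. [folklore] -/
theorem integrableOn_theta : IntegrableOn (theta M ψ) (Ioi 0) := by
  have h : MellinConvergent (theta M ψ) 1 :=
    mellinConvergent_of_isBigO_rpow (a := 2) (b := 0)
      ((continuousOn_theta M ψ).locallyIntegrableOn measurableSet_Ioi)
      (isBigO_atTop_theta M ψ 2) (by simp only [Complex.one_re]; norm_num)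
      (isBigO_nhdsGT_theta M ψ 0) (by simp only [Complex.one_re]; norm_num)
  refine IntegrableOn.congr_fun h (fun t _ ↦ ?_) measurableSet_Ioi
  simp only [sub_self, Complex.cpow_zero, one_smul]

/-- The Mellin transform of `θ_ψ` at `s = 1` is `∫₀^∞ θ_ψ(t) dt`. [folklore] -/
theorem mellin_theta_one : mellin (theta M ψ) 1 = ∫ t in Ioi (0 : ℝ), theta M ψ t := by
  unfold mellin
  refine setIntegral_congr_fun measurableSet_Ioi (fun t _ ↦ ?_)
  simp only [sub_self, Complex.cpow_zero, one_smul]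

/-- **`L_ψ(1) = (π/M) ∫₀^∞ θ_ψ(t) dt`** (`thetaLFunction` at `s = 1`; `Γ(1) = 1`). [folklore] -/
theorem thetaLFunction_one :
    thetaLFunction M ψ 1 = (π : ℂ) / (M : ℂ) * ∫ t in Ioi (0 : ℝ), theta M ψ t := by
  unfold thetaLFunction
  rw [mellin_theta_one, Complex.Gamma_one, Complex.cpow_one, Complex.cpow_neg_one, inv_one,
    mul_one, div_eq_mul_inv]

/-! ### Termwise integration on `[y, ∞)` -/

variable {M ψ}

omit [NeZero M] in
/-- The exponent of `thetaTerm`: `-π t N(x)/M = (-(π N(x)/M)) · t`. [folklore] -/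
theorem thetaTerm_eq (t : ℝ) (x : GaussianInt) :
    thetaTerm M ψ t x = ψ x * (x : ℂ) *
      ((rexp (-(π * ((x.norm : ℤ) : ℝ) / M) * t) : ℝ) : ℂ) := by
  simp only [thetaTerm]
  congr 3
  ring

/-- For `x ≠ 0` the rate `π N(x)/M` is positive. [folklore] -/
theorem rate_pos {x : GaussianInt} (hx : x ≠ 0) : 0 < π * ((x.norm : ℤ) : ℝ) / M := by
  have hM : (0 : ℝ) < M := by exact_mod_cast Nat.pos_of_ne_zero (NeZero.ne M)
  have hN : (0 : ℝ) < ((x.norm : ℤ) : ℝ) := by exact_mod_cast GaussianInt.norm_pos.mpr hx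
  positivity

/-- `∫_y^∞ e^{-a t} dt = e^{-a y}/a` for `a > 0`. [folklore] -/
theorem integral_Ioi_exp_neg_mul {a : ℝ} (ha : 0 < a) (y : ℝ) :
    ∫ t in Ioi y, rexp (-a * t) = rexp (-a * y) / a := by
  rw [integral_exp_mul_Ioi (by linarith : -a < 0) y]
  field_simp

/-- Each term `t ↦ ψ(x) x e^{-π t N(x)/M}` is integrable on `(y, ∞)`. [folklore] -/
theorem integrableOn_thetaTerm (y : ℝ) (x : GaussianInt) :
    IntegrableOn (fun t ↦ thetaTerm M ψ t x) (Ioi y) := by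
  rcases eq_or_ne x 0 with rfl | hx
  · have : (fun t ↦ thetaTerm M ψ t 0) = fun _ ↦ 0 := by
      funext t; simp [thetaTerm]
    rw [this]
    exact integrableOn_zero
  · simp_rw [thetaTerm_eq]
    have h := (integrableOn_exp_mul_Ioi (by linarith [rate_pos (M := M) hx] :
      -(π * ((x.norm : ℤ) : ℝ) / M) < 0) y).ofReal (𝕜 := ℂ)
    exact h.const_mul _

/-- **`∫_y^∞ ψ(x) x e^{-π t N(x)/M} dt = (M/π) ψ(x) (x/N(x)) e^{-π y N(x)/M}`** (for `x = 0`
both sides vanish). [folklore] -/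
theorem integral_Ioi_thetaTerm (y : ℝ) (x : GaussianInt) :
    ∫ t in Ioi y, thetaTerm M ψ t x =
      (M : ℂ) / π * (ψ x * (x : ℂ) / ((x.norm : ℤ) : ℂ) *
        ((rexp (-(π * ((x.norm : ℤ) : ℝ) / M) * y) : ℝ) : ℂ)) := by
  rcases eq_or_ne x 0 with rfl | hx
  · simp [thetaTerm]
  · have ha := rate_pos (M := M) hx
    have hN : ((x.norm : ℤ) : ℂ) ≠ 0 := by exact_mod_cast (GaussianInt.norm_pos.mpr hx).ne'
    have hπ : (π : ℂ) ≠ 0 := Complex.ofReal_ne_zero.mpr Real.pi_ne_zero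
    have hMc : (M : ℂ) ≠ 0 := Nat.cast_ne_zero.mpr (NeZero.ne M)
    simp_rw [thetaTerm_eq]
    rw [integral_const_mul, integral_complex_ofReal, integral_Ioi_exp_neg_mul ha y]
    push_cast
    field_simp

/-- **The norms integrate to `‖ψ(x)‖ ‖x‖ (M/(π N(x))) e^{-π y N(x)/M}`** (`x ≠ 0`).
[folklore] -/
theorem integral_Ioi_norm_thetaTerm (y : ℝ) {x : GaussianInt} (hx : x ≠ 0) :
    ∫ t in Ioi y, ‖thetaTerm M ψ t x‖ =
      ‖ψ x‖ * ‖(x : ℂ)‖ * (rexp (-(π * ((x.norm : ℤ) : ℝ) / M) * y) /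
        (π * ((x.norm : ℤ) : ℝ) / M)) := by
  have ha := rate_pos (M := M) hx
  have hnorm : ∀ t, ‖thetaTerm M ψ t x‖ =
      ‖ψ x‖ * ‖(x : ℂ)‖ * rexp (-(π * ((x.norm : ℤ) : ℝ) / M) * t) := by
    intro t
    rw [thetaTerm_eq, norm_mul, norm_mul, Complex.norm_real, Real.norm_eq_abs,
      abs_of_pos (Real.exp_pos _)]
  simp_rw [hnorm]
  rw [integral_const_mul, integral_Ioi_exp_neg_mul ha y]

/-- The integrals of the norms are summable over `x ∈ ℤ[i]` (bounded by a Gaussian sum).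
[folklore] -/
theorem summable_integral_Ioi_norm_thetaTerm (hψ : ∀ x y : GaussianInt, ψ (x + M * y) = ψ x)
    {y : ℝ} (hy : 0 < y) :
    Summable fun x : GaussianInt ↦ ∫ t in Ioi y, ‖thetaTerm M ψ t x‖ := by
  have hM : (0 : ℝ) < M := by exact_mod_cast Nat.pos_of_ne_zero (NeZero.ne M)
  set B : ℝ := ∑ c : ZMod M × ZMod M, ‖ψ (rep M c 0)‖ with hB
  have hB0 : 0 ≤ B := Finset.sum_nonneg fun _ _ ↦ norm_nonneg _
  have hc : 0 < π / M * y := by positivity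
  have hdom := (summable_exp_neg_mul_norm hc).mul_left (B * (M / π))
  refine Summable.of_nonneg_of_le (fun x ↦ integral_nonneg fun t ↦ norm_nonneg _)
    (fun x ↦ ?_) hdom
  rcases eq_or_ne x 0 with rfl | hx
  · have : (fun t ↦ ‖thetaTerm M ψ t 0‖) = fun _ ↦ 0 := by
      funext t; simp [thetaTerm]
    rw [this, integral_zero]
    exact mul_nonneg (mul_nonneg hB0 (by positivity)) (Real.exp_pos _).le
  · rw [integral_Ioi_norm_thetaTerm y hx]
    have hN1 : (1 : ℝ) ≤ ((x.norm : ℤ) : ℝ) := by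
      exact_mod_cast GaussianInt.norm_pos.mpr hx
    have hN : (0 : ℝ) < ((x.norm : ℤ) : ℝ) := by linarith
    have hxn : ‖(x : ℂ)‖ ≤ ((x.norm : ℤ) : ℝ) := by
      rw [norm_toComplex]
      calc (((x.norm : ℤ) : ℝ)) ^ (1 / 2 : ℝ) ≤ (((x.norm : ℤ) : ℝ)) ^ (1 : ℝ) :=
            Real.rpow_le_rpow_of_exponent_le hN1 (by norm_num)
        _ = ((x.norm : ℤ) : ℝ) := Real.rpow_one _
    have hexp : rexp (-(π * ((x.norm : ℤ) : ℝ) / M) * y) =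
        rexp (-(π / M * y) * ((x.norm : ℤ) : ℝ)) := by
      congr 1; ring
    rw [hexp]
    have hψx : ‖ψ x‖ ≤ B := norm_le_of_periodic M ψ hψ x
    have hE := (Real.exp_pos (-(π / M * y) * ((x.norm : ℤ) : ℝ))).le
    calc ‖ψ x‖ * ‖(x : ℂ)‖ * (rexp (-(π / M * y) * ((x.norm : ℤ) : ℝ)) /
          (π * ((x.norm : ℤ) : ℝ) / M))
        = ‖ψ x‖ * (‖(x : ℂ)‖ / ((x.norm : ℤ) : ℝ)) * (M / π) *
            rexp (-(π / M * y) * ((x.norm : ℤ) : ℝ)) := by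
          field_simp
      _ ≤ B * 1 * (M / π) * rexp (-(π / M * y) * ((x.norm : ℤ) : ℝ)) := by
          gcongr
          exact (div_le_one hN).mpr hxn
      _ = B * (M / π) * rexp (-(π / M * y) * ((x.norm : ℤ) : ℝ)) := by ring

/-- **Termwise integration on `[y, ∞)`**: for `ψ` periodic modulo `M` and `y > 0`,
`∫_y^∞ θ_ψ(t) dt = (M/π) ∑_{x ∈ ℤ[i]} ψ(x) (x/N(x)) e^{-π y N(x)/M}` (absolutely
convergent). [folklore] -/
theorem hasSum_setIntegral_Ioi_theta (hψ : ∀ x y : GaussianInt, ψ (x + M * y) = ψ x) {y : ℝ}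
    (hy : 0 < y) :
    HasSum (fun x : GaussianInt ↦ (M : ℂ) / π * (ψ x * (x : ℂ) / ((x.norm : ℤ) : ℂ) *
      ((rexp (-(π * ((x.norm : ℤ) : ℝ) / M) * y) : ℝ) : ℂ)))
      (∫ t in Ioi y, theta M ψ t) := by
  have hint : ∀ x : GaussianInt,
      Integrable (fun t ↦ thetaTerm M ψ t x) (volume.restrict (Ioi y)) :=
    fun x ↦ integrableOn_thetaTerm y x
  have h := hasSum_integral_of_summable_integral_norm hint
    (summable_integral_Ioi_norm_thetaTerm hψ hy)
  have heq : ∫ t in Ioi y, (∑' x : GaussianInt, thetaTerm M ψ t x) =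
      ∫ t in Ioi y, theta M ψ t := by
    refine setIntegral_congr_fun measurableSet_Ioi (fun t ht ↦ ?_)
    exact (hasSum_theta M ψ hψ (hy.trans ht)).tsum_eq
  rw [heq] at h
  refine h.congr_fun fun x ↦ ?_
  exact (integral_Ioi_thetaTerm y x).symm

/-! ### The limit `y → 0⁺` -/

variable (M ψ)

/-- `∫_y^∞ θ_ψ → ∫₀^∞ θ_ψ` as `y → 0⁺` (dominated convergence, `θ_ψ` integrable on
`(0, ∞)`). [folklore] -/
theorem tendsto_setIntegral_Ioi_theta :
    Tendsto (fun y : ℝ ↦ ∫ t in Ioi y, theta M ψ t) (𝓝[>] 0)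
      (𝓝 (∫ t in Ioi (0 : ℝ), theta M ψ t)) := by
  have hθ := integrableOn_theta M ψ
  -- dominated convergence for the indicators of `(y, ∞)` on `(0, ∞)`
  have hlim : Tendsto (fun y : ℝ ↦ ∫ t in Ioi (0 : ℝ), (Ioi y).indicator (theta M ψ) t)
      (𝓝[>] 0) (𝓝 (∫ t in Ioi (0 : ℝ), theta M ψ t)) := by
    refine tendsto_integral_filter_of_dominated_convergence (fun t ↦ ‖theta M ψ t‖)
      (Eventually.of_forall fun y ↦
        hθ.aestronglyMeasurable.indicator measurableSet_Ioi)
      (Eventually.of_forall fun y ↦ ae_of_all _ fun t ↦ norm_indicator_le_norm_self _ _)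
      hθ.norm ?_
    refine (ae_restrict_iff' measurableSet_Ioi).2 (ae_of_all _ fun t (ht : 0 < t) ↦ ?_)
    have hev : ∀ᶠ y : ℝ in 𝓝[>] 0, (Ioi y).indicator (theta M ψ) t = theta M ψ t := by
      have h1 : ∀ᶠ y : ℝ in 𝓝[>] 0, y < t := nhdsWithin_le_nhds (Iio_mem_nhds ht)
      filter_upwards [h1] with y hy
      exact indicator_of_mem (mem_Ioi.mpr hy) _
    exact tendsto_const_nhds.congr' (hev.mono fun y hy ↦ hy.symm)
  refine hlim.congr' ?_
  filter_upwards [self_mem_nhdsWithin] with y (hy : 0 < y)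
  rw [setIntegral_indicator measurableSet_Ioi, Ioi_inter_Ioi, sup_eq_right.mpr hy.le]

/-- `y ↦ c y` maps `0⁺` to `0⁺` for `c > 0`. [folklore] -/
theorem tendsto_const_mul_nhdsGT_zero {c : ℝ} (hc : 0 < c) :
    Tendsto (fun y : ℝ ↦ c * y) (𝓝[>] 0) (𝓝[>] 0) := by
  refine tendsto_nhdsWithin_iff.mpr ⟨?_, ?_⟩
  · have h : Tendsto (fun y : ℝ ↦ c * y) (𝓝 0) (𝓝 (c * 0)) :=
      (continuous_const.mul continuous_id).tendsto 0
    rw [mul_zero] at h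
    exact h.mono_left nhdsWithin_le_nhds
  · filter_upwards [self_mem_nhdsWithin] with y (hy : 0 < y)
    exact mem_Ioi.mpr (mul_pos hc hy)

/-- **`L_ψ(1) = lim_{y → 0⁺} ∑_x ψ(x) (x/N(x)) e^{-π y N(x)/M}`** (normalised exponent).
[folklore] -/
theorem tendsto_tsum_thetaLFunction_one' (hψ : ∀ x y : GaussianInt, ψ (x + M * y) = ψ x) :
    Tendsto (fun y : ℝ ↦ ∑' x : GaussianInt, ψ x * (x : ℂ) / ((x.norm : ℤ) : ℂ) *
      ((rexp (-(π * ((x.norm : ℤ) : ℝ) / M) * y) : ℝ) : ℂ)) (𝓝[>] 0)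
      (𝓝 (thetaLFunction M ψ 1)) := by
  have hπ : (π : ℂ) ≠ 0 := Complex.ofReal_ne_zero.mpr Real.pi_ne_zero
  have hMc : (M : ℂ) ≠ 0 := Nat.cast_ne_zero.mpr (NeZero.ne M)
  have h1 := (tendsto_setIntegral_Ioi_theta M ψ).const_mul ((π : ℂ) / M)
  rw [← thetaLFunction_one] at h1
  refine h1.congr' ?_
  filter_upwards [self_mem_nhdsWithin] with y (hy : 0 < y)
  rw [← (hasSum_setIntegral_Ioi_theta hψ hy).tsum_eq, ← tsum_mul_left]
  refine tsum_congr fun x ↦ ?_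
  field_simp

/-- **The value at `s = 1` as a limit of Gaussian-damped lattice sums**: for `ψ : ℤ[i] → ℂ`
periodic modulo `M ≥ 1`,
`thetaLFunction M ψ 1 = lim_{y → 0⁺} ∑_{x ∈ ℤ[i]} ψ(x) (x/N(x)) e^{-y N(x)}`.
For the Hecke character of `E_n : y² = x³ - n² x` (`ψ = heckePsi n`, `M = 4n`,
`CongruentNumberCurveHeckeSeries`) the left side is `4 L(E_n, 1)` and the sum is
`4 ∑_{α primary} (n/N(α)) e^{-y N(α)}/ᾱ`, the Eisenstein–Kronecker regularisation behind the
classical evaluations of `L(E_n, 1)` (Birch–Swinnerton-Dyer 1965, §3). [folklore] -/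
theorem tendsto_tsum_thetaLFunction_one (hψ : ∀ x y : GaussianInt, ψ (x + M * y) = ψ x) :
    Tendsto (fun y : ℝ ↦ ∑' x : GaussianInt, ψ x * (x : ℂ) / ((x.norm : ℤ) : ℂ) *
      ((rexp (-y * ((x.norm : ℤ) : ℝ)) : ℝ) : ℂ)) (𝓝[>] 0)
      (𝓝 (thetaLFunction M ψ 1)) := by
  have hM : (0 : ℝ) < M := by exact_mod_cast Nat.pos_of_ne_zero (NeZero.ne M)
  have h := (tendsto_tsum_thetaLFunction_one' M ψ hψ).comp
    (tendsto_const_mul_nhdsGT_zero (c := M / π) (by positivity))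
  refine h.congr fun y ↦ ?_
  simp only [Function.comp_apply]
  refine tsum_congr fun x ↦ ?_
  congr 3
  field_simp

end GaussianTheta

end Literature.NumberTheory.LFunctions

end
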